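import Literature.Analysis.Fourier.HilbertTransformLine
import Literature.Analysis.SpecialFunctions.ArcsinePoissonIntegral
import Mathlib.Analysis.SpecialFunctions.Arsinh
import Mathlib.Analysis.SpecialFunctions.Sqrt
import HarnessLib

/-!
# SHEET-ℝ frame: the Hilbert transform of the inverse square root `(L² + ξ²)^{-1/2}`
# (closed form behind the far-field shape `T₂` of the certificate frame)

HONEST FRAMING (cell ns-blowup GROUP B / zone Z3, case Z3-SR-CERT; 1-D MODEL certificate frame; not Euler/NS).

The interval stage of the SHEET-ℝ certificate (cert-1 `SHEET-R-PRICE-impl1.md` §4 T1, cert-4 F5(b) design) evaluates the Hilbert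
transform and the velocity of the far-field shape `T₂` in CLOSED FORM, starting from the classical pair

  `H[(L² + y²)^{-1/2}](x) = (2/π) · arsinh(x/L) · (L² + x²)^{-1/2}`      (`L > 0`),

with `H` the tree's p.v. operator `Literature.Analysis.Fourier.hilbertTransform` (convention `H cos = sin`). This file PROVES that
pair from the definition, in the pattern of the tree's `hilbertTransform_inv_one_add_sq`: the symmetric integrand of
`f(y) = (1 + y²)^{-1/2}` at `x` is `4x/(√A·√B·(√A + √B))`, `A = 1 + (x − t)²`, `B = 1 + (x + t)²` (dominated by `2|x|/(1 + t²)`), an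
explicit primitive is `G(t) = (1 + x²)^{-1/2}·[log(1 + x² + xt + √(1+x²)√B) − log(1 + x² − xt + √(1+x²)√A)]` (regular at `t = 0`,
`G(0) = 0`), and `G(t) → (1 + x²)^{-1/2}·log((√(1+x²) + x)/(√(1+x²) − x)) = 2·arsinh(x)·(1 + x²)^{-1/2}` as `t → ∞`; the height-`L`
form follows by dilation covariance (`hilbertTransform_comp_div`). Classical table entry (e.g. King, *Hilbert Transforms* Vol. 2,
Appendix 1, algebraic functions) — background only; everything here is proved. Pure calculus; no definition, no named fact;
MODEL frame bookkeeping only.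
-/

noncomputable section

namespace Summit.NavierStokesRegularity.OSWSelfSimilar
namespace SheetRFarFieldHilbert

open _root_.MeasureTheory _root_.Set _root_.Filter _root_.Real
open scoped Real Topology
open Literature.Analysis.Fourier
open Literature.Analysis.SpecialFunctions (one_le_sqrt_one_add_sq)

/-! ### Square-root bookkeeping -/

-- `1 ≤ √(1 + s²)` is the tree's `Literature.Analysis.SpecialFunctions.one_le_sqrt_one_add_sq`; `0 < √(1 + s²)` is `positivity`.

/-- `√(1 + s²)·√(1 + s²) = 1 + s²`. [folklore] -/
theorem sqrt_one_add_sq_mul_self (s : ℝ) : √(1 + s ^ 2) * √(1 + s ^ 2) = 1 + s ^ 2 :=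
  Real.mul_self_sqrt (by positivity)

/-- `√(1 + x²)·√(1 + s²) ≥ 1 + |x·s|` (Cauchy–Schwarz). [folklore] -/
theorem one_add_abs_mul_le_sqrt_mul_sqrt (x s : ℝ) : 1 + |x * s| ≤ √(1 + x ^ 2) * √(1 + s ^ 2) := by
  rw [← Real.sqrt_mul (by positivity)]
  refine Real.le_sqrt_of_sq_le ?_
  rw [abs_mul]
  nlinarith [sq_nonneg (|x| - |s|), sq_abs x, sq_abs s, abs_nonneg x, abs_nonneg s]

/-- `2 ≤ 1 + x·s + √(1+x²)√(1+s²)` — the arguments of the logarithms in the primitive are `≥ 2`. [folklore] -/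
theorem two_le_logArg (x s : ℝ) : 2 ≤ 1 + x * s + √(1 + x ^ 2) * √(1 + s ^ 2) := by
  have h := one_add_abs_mul_le_sqrt_mul_sqrt x s
  have h2 : -(x * s) ≤ |x * s| := neg_le_abs _
  linarith

/-- `N_B(t) := 1 + x² + x t + √(1+x²)√(1+(x+t)²) ≥ 2`. [folklore] -/
theorem two_le_NB (x t : ℝ) : 2 ≤ 1 + x ^ 2 + x * t + √(1 + x ^ 2) * √(1 + (x + t) ^ 2) := by
  have h := two_le_logArg x (x + t)
  nlinarith [h]

/-- `N_A(t) := 1 + x² − x t + √(1+x²)√(1+(x−t)²) ≥ 2`. [folklore] -/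
theorem two_le_NA (x t : ℝ) : 2 ≤ 1 + x ^ 2 - x * t + √(1 + x ^ 2) * √(1 + (x - t) ^ 2) := by
  have h := two_le_logArg x (x - t)
  nlinarith [h]

/-! ### The symmetric integrand of `(1 + y²)^{-1/2}` -/

/-- For `t ≠ 0`: `((1+(x−t)²)^{-1/2} − (1+(x+t)²)^{-1/2})/t = 4x/(√A√B(√A+√B))`, `A = 1+(x−t)²`, `B = 1+(x+t)²`. [folklore] -/
theorem invSqrt_symm_integrand (x : ℝ) {t : ℝ} (ht : t ≠ 0) :
    ((√(1 + (x - t) ^ 2))⁻¹ - (√(1 + (x + t) ^ 2))⁻¹) / t =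
      4 * x / (√(1 + (x - t) ^ 2) * √(1 + (x + t) ^ 2) * (√(1 + (x - t) ^ 2) + √(1 + (x + t) ^ 2))) := by
  set u := √(1 + (x - t) ^ 2) with hu_def
  set v := √(1 + (x + t) ^ 2) with hv_def
  have hu0 : 0 < u := by rw [hu_def]; positivity
  have hv0 : 0 < v := by rw [hv_def]; positivity
  have hu : u * u = 1 + (x - t) ^ 2 := sqrt_one_add_sq_mul_self _
  have hv : v * v = 1 + (x + t) ^ 2 := sqrt_one_add_sq_mul_self _
  have huv : 0 < u + v := by positivity
  rw [div_eq_div_iff ht (by positivity)]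
  field_simp
  linear_combination hv - hu

/-- The integrand is dominated by `2|x|/(1 + t²)`. [folklore] -/
theorem abs_invSqrt_symm_integrand_le (x t : ℝ) :
    |4 * x / (√(1 + (x - t) ^ 2) * √(1 + (x + t) ^ 2) * (√(1 + (x - t) ^ 2) + √(1 + (x + t) ^ 2)))| ≤
      2 * |x| * (1 + t ^ 2)⁻¹ := by
  set u := √(1 + (x - t) ^ 2) with hu_def
  set v := √(1 + (x + t) ^ 2) with hv_def
  have hu1 : 1 ≤ u := one_le_sqrt_one_add_sq _
  have hv1 : 1 ≤ v := one_le_sqrt_one_add_sq _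
  have hu : u * u = 1 + (x - t) ^ 2 := sqrt_one_add_sq_mul_self _
  have hv : v * v = 1 + (x + t) ^ 2 := sqrt_one_add_sq_mul_self _
  have hden : 2 * (1 + t ^ 2) ≤ u * v * (u + v) := by
    -- `u v (u + v) = u²·v + v²·u ≥ u² + v² = 2 + 2x² + 2t² ≥ 2(1 + t²)`
    nlinarith [mul_nonneg (by positivity : (0:ℝ) ≤ u * u) (by linarith : (0:ℝ) ≤ v - 1),
      mul_nonneg (by positivity : (0:ℝ) ≤ v * v) (by linarith : (0:ℝ) ≤ u - 1), sq_nonneg x]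
  have hpos : 0 < u * v * (u + v) := by positivity
  rw [abs_div, abs_of_pos hpos, abs_mul, abs_of_pos (by norm_num : (0:ℝ) < 4), ← div_eq_mul_inv,
    div_le_div_iff₀ hpos (by positivity)]
  nlinarith [abs_nonneg x, hden]

/-- The integrand `4x/(√A√B(√A+√B))` is integrable on `ℝ`. [folklore] -/
theorem integrable_invSqrt_symm_integrand (x : ℝ) :
    Integrable fun t : ℝ =>
      4 * x / (√(1 + (x - t) ^ 2) * √(1 + (x + t) ^ 2) * (√(1 + (x - t) ^ 2) + √(1 + (x + t) ^ 2))) := by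
  refine Integrable.mono' (integrable_inv_one_add_sq.const_mul (2 * |x|)) ?_
    (Eventually.of_forall fun t => ?_)
  · refine Continuous.aestronglyMeasurable ?_
    exact Continuous.div continuous_const (by fun_prop) fun t => by positivity
  · rw [Real.norm_eq_abs]
    exact abs_invSqrt_symm_integrand_le x t

/-! ### The primitive -/

/-- `d/dt √(1 + (x + t)²) = (x + t)/√(1 + (x + t)²)`. [folklore] -/
theorem hasDerivAt_sqrt_one_add_sq_add (x t : ℝ) :
    HasDerivAt (fun t : ℝ => √(1 + (x + t) ^ 2)) ((x + t) / √(1 + (x + t) ^ 2)) t := by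
  have h1 : HasDerivAt (fun t : ℝ => 1 + (x + t) ^ 2) (2 * (x + t)) t := by
    have h := (((hasDerivAt_id t).const_add x).pow 2).const_add 1
    refine h.congr_deriv ?_
    simp
  have h2 := h1.sqrt (by positivity : 1 + (x + t) ^ 2 ≠ 0)
  refine h2.congr_deriv ?_
  have : √(1 + (x + t) ^ 2) ≠ 0 := by positivity
  field_simp

/-- `d/dt √(1 + (x − t)²) = −(x − t)/√(1 + (x − t)²)`. [folklore] -/
theorem hasDerivAt_sqrt_one_add_sq_sub (x t : ℝ) :
    HasDerivAt (fun t : ℝ => √(1 + (x - t) ^ 2)) (-(x - t) / √(1 + (x - t) ^ 2)) t := by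
  have h1 : HasDerivAt (fun t : ℝ => 1 + (x - t) ^ 2) (-(2 * (x - t))) t := by
    have h := (((hasDerivAt_id t).const_sub x).pow 2).const_add 1
    refine h.congr_deriv ?_
    simp
  have h2 := h1.sqrt (by positivity : 1 + (x - t) ^ 2 ≠ 0)
  refine h2.congr_deriv ?_
  have : √(1 + (x - t) ^ 2) ≠ 0 := by positivity
  field_simp

/-- The algebra of the derivative of the primitive, in the atoms `u = √A`, `v = √B`, `w = √(1+x²)`. [folklore] -/
theorem primitive_deriv_identity {x t u v w : ℝ} (hu0 : 0 < u) (hv0 : 0 < v) (hw0 : 0 < w)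
    (hu : u * u = 1 + (x - t) ^ 2) (hv : v * v = 1 + (x + t) ^ 2) (hw : w * w = 1 + x ^ 2)
    (hNB : 0 < 1 + x ^ 2 + x * t + w * v) (hNA : 0 < 1 + x ^ 2 - x * t + w * u) :
    ((x + w * ((x + t) / v)) / (1 + x ^ 2 + x * t + w * v) -
        (-x + w * (-(x - t) / u)) / (1 + x ^ 2 - x * t + w * u)) / w =
      4 * x / (u * v * (u + v)) := by
  have hB1 : (x + w * ((x + t) / v)) / (1 + x ^ 2 + x * t + w * v) = (2 * x + t) / (v * (v + w)) := by
    rw [div_eq_div_iff hNB.ne' (by positivity), div_eq_mul_inv]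
    have hinv : v * v⁻¹ = 1 := mul_inv_cancel₀ hv0.ne'
    linear_combination x * hv + (x + t) * hw + (w * (x + t) * (v + w)) * hinv
  have hA1 : (-x + w * (-(x - t) / u)) / (1 + x ^ 2 - x * t + w * u) = (t - 2 * x) / (u * (u + w)) := by
    rw [div_eq_div_iff hNA.ne' (by positivity), div_eq_mul_inv]
    have hinv : u * u⁻¹ = 1 := mul_inv_cancel₀ hu0.ne'
    linear_combination (-x) * hu - (x - t) * hw - (w * (x - t) * (u + w)) * hinv
  rw [hB1, hA1, div_sub_div _ _ (by positivity) (by positivity), div_div,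
    div_eq_div_iff (by positivity) (by positivity)]
  linear_combination (u * v * (2 * x + t) * (u + v + w)) * hu - (u * v * (t - 2 * x) * (u + v + w)) * hv -
    (4 * x * u * v * (u + v + w)) * hw

/-- **The primitive.** `G(t) = [log(1 + x² + xt + √(1+x²)√(1+(x+t)²)) − log(1 + x² − xt + √(1+x²)√(1+(x−t)²))]/√(1+x²)` has
derivative `4x/(√A√B(√A+√B))` at every `t`. [folklore] -/
theorem hasDerivAt_invSqrt_primitive (x t : ℝ) :
    HasDerivAt (fun t : ℝ => (Real.log (1 + x ^ 2 + x * t + √(1 + x ^ 2) * √(1 + (x + t) ^ 2)) -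
        Real.log (1 + x ^ 2 - x * t + √(1 + x ^ 2) * √(1 + (x - t) ^ 2))) / √(1 + x ^ 2))
      (4 * x / (√(1 + (x - t) ^ 2) * √(1 + (x + t) ^ 2) * (√(1 + (x - t) ^ 2) + √(1 + (x + t) ^ 2)))) t := by
  have hw0 : 0 < √(1 + x ^ 2) := by positivity
  have hNB : 0 < 1 + x ^ 2 + x * t + √(1 + x ^ 2) * √(1 + (x + t) ^ 2) := by linarith [two_le_NB x t]
  have hNA : 0 < 1 + x ^ 2 - x * t + √(1 + x ^ 2) * √(1 + (x - t) ^ 2) := by linarith [two_le_NA x t]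
  have dNB : HasDerivAt (fun t : ℝ => 1 + x ^ 2 + x * t + √(1 + x ^ 2) * √(1 + (x + t) ^ 2))
      (x + √(1 + x ^ 2) * ((x + t) / √(1 + (x + t) ^ 2))) t := by
    have h := (((hasDerivAt_id t).const_mul x).const_add (1 + x ^ 2)).add
      ((hasDerivAt_sqrt_one_add_sq_add x t).const_mul (√(1 + x ^ 2)))
    refine h.congr_deriv ?_
    simp
  have dNA : HasDerivAt (fun t : ℝ => 1 + x ^ 2 - x * t + √(1 + x ^ 2) * √(1 + (x - t) ^ 2))
      (-x + √(1 + x ^ 2) * (-(x - t) / √(1 + (x - t) ^ 2))) t := by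
    have h := (((hasDerivAt_id t).const_mul x).const_sub (1 + x ^ 2)).add
      ((hasDerivAt_sqrt_one_add_sq_sub x t).const_mul (√(1 + x ^ 2)))
    refine h.congr_deriv ?_
    simp
  have h := ((dNB.log hNB.ne').sub (dNA.log hNA.ne')).div_const (√(1 + x ^ 2))
  refine h.congr_deriv ?_
  exact primitive_deriv_identity (by positivity) (by positivity) hw0
    (sqrt_one_add_sq_mul_self _) (sqrt_one_add_sq_mul_self _) (sqrt_one_add_sq_mul_self _) hNB hNA

/-! ### Limits at `+∞` -/

/-- `√(1 + (x + t)²)/t → 1` as `t → +∞`. [folklore] -/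
theorem tendsto_sqrt_one_add_sq_add_div_atTop (x : ℝ) :
    Tendsto (fun t : ℝ => √(1 + (x + t) ^ 2) / t) atTop (𝓝 1) := by
  have h1 : Tendsto (fun t : ℝ => t⁻¹) atTop (𝓝 0) := tendsto_inv_atTop_zero
  have h2 : Tendsto (fun t : ℝ => (t⁻¹) ^ 2 + (x * t⁻¹ + 1) ^ 2) atTop (𝓝 ((0:ℝ) ^ 2 + (x * 0 + 1) ^ 2)) :=
    (h1.pow 2).add (((h1.const_mul x).add_const 1).pow 2)
  have h3 := h2.sqrt
  rw [show √((0:ℝ) ^ 2 + (x * 0 + 1) ^ 2) = 1 by norm_num] at h3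
  refine h3.congr' ?_
  filter_upwards [eventually_gt_atTop (0:ℝ)] with t ht
  have ht0 : t ≠ 0 := ht.ne'
  have heq : (t⁻¹) ^ 2 + (x * t⁻¹ + 1) ^ 2 = (1 + (x + t) ^ 2) * (t⁻¹) ^ 2 := by
    field_simp
  rw [heq, Real.sqrt_mul (by positivity), Real.sqrt_sq (inv_nonneg.2 ht.le), div_eq_mul_inv]

/-- `√(1 + (x − t)²)/t → 1` as `t → +∞`. [folklore] -/
theorem tendsto_sqrt_one_add_sq_sub_div_atTop (x : ℝ) :
    Tendsto (fun t : ℝ => √(1 + (x - t) ^ 2) / t) atTop (𝓝 1) := by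
  have h1 : Tendsto (fun t : ℝ => t⁻¹) atTop (𝓝 0) := tendsto_inv_atTop_zero
  have h2 : Tendsto (fun t : ℝ => (t⁻¹) ^ 2 + (x * t⁻¹ - 1) ^ 2) atTop (𝓝 ((0:ℝ) ^ 2 + (x * 0 - 1) ^ 2)) :=
    (h1.pow 2).add (((h1.const_mul x).sub_const 1).pow 2)
  have h3 := h2.sqrt
  rw [show √((0:ℝ) ^ 2 + (x * 0 - 1) ^ 2) = 1 by norm_num] at h3
  refine h3.congr' ?_
  filter_upwards [eventually_gt_atTop (0:ℝ)] with t ht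
  have ht0 : t ≠ 0 := ht.ne'
  have heq : (t⁻¹) ^ 2 + (x * t⁻¹ - 1) ^ 2 = (1 + (x - t) ^ 2) * (t⁻¹) ^ 2 := by
    field_simp
  rw [heq, Real.sqrt_mul (by positivity), Real.sqrt_sq (inv_nonneg.2 ht.le), div_eq_mul_inv]

/-- `N_B(t)/t → x + √(1+x²)` as `t → +∞`. [folklore] -/
theorem tendsto_NB_div_atTop (x : ℝ) :
    Tendsto (fun t : ℝ => (1 + x ^ 2 + x * t + √(1 + x ^ 2) * √(1 + (x + t) ^ 2)) / t) atTop
      (𝓝 (x + √(1 + x ^ 2))) := by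
  have h1 : Tendsto (fun t : ℝ => (1 + x ^ 2) * t⁻¹) atTop (𝓝 ((1 + x ^ 2) * 0)) :=
    tendsto_inv_atTop_zero.const_mul _
  have h := (h1.add_const x).add ((tendsto_sqrt_one_add_sq_add_div_atTop x).const_mul (√(1 + x ^ 2)))
  rw [mul_zero, zero_add, mul_one] at h
  refine h.congr' ?_
  filter_upwards [eventually_gt_atTop (0:ℝ)] with t ht
  have ht0 : t ≠ 0 := ht.ne'
  field_simp

/-- `N_A(t)/t → √(1+x²) − x` as `t → +∞`. [folklore] -/
theorem tendsto_NA_div_atTop (x : ℝ) :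
    Tendsto (fun t : ℝ => (1 + x ^ 2 - x * t + √(1 + x ^ 2) * √(1 + (x - t) ^ 2)) / t) atTop
      (𝓝 (√(1 + x ^ 2) - x)) := by
  have h1 : Tendsto (fun t : ℝ => (1 + x ^ 2) * t⁻¹) atTop (𝓝 ((1 + x ^ 2) * 0)) :=
    tendsto_inv_atTop_zero.const_mul _
  have h := (h1.sub_const x).add ((tendsto_sqrt_one_add_sq_sub_div_atTop x).const_mul (√(1 + x ^ 2)))
  rw [mul_zero, zero_sub, mul_one, show -x + √(1 + x ^ 2) = √(1 + x ^ 2) - x by ring] at h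
  refine h.congr' ?_
  filter_upwards [eventually_gt_atTop (0:ℝ)] with t ht
  have ht0 : t ≠ 0 := ht.ne'
  field_simp

/-- `0 < √(1 + x²) − x` (`|x| < √(1 + x²)`). [folklore] -/
theorem sqrt_one_add_sq_sub_pos (x : ℝ) : 0 < √(1 + x ^ 2) - x := by
  have h : |x| < √(1 + x ^ 2) := by
    rw [← Real.sqrt_sq_eq_abs]
    exact Real.sqrt_lt_sqrt (sq_nonneg x) (by linarith)
  linarith [le_abs_self x]

/-- `0 < x + √(1 + x²)` (`|x| < √(1 + x²)`). [folklore] -/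
theorem add_sqrt_one_add_sq_pos (x : ℝ) : 0 < x + √(1 + x ^ 2) := by
  have h : |x| < √(1 + x ^ 2) := by
    rw [← Real.sqrt_sq_eq_abs]
    exact Real.sqrt_lt_sqrt (sq_nonneg x) (by linarith)
  linarith [neg_abs_le x]

/-- The limit of the primitive: `G(t) → (log(x + √(1+x²)) − log(√(1+x²) − x))/√(1+x²)` as `t → +∞`. [folklore] -/
theorem tendsto_invSqrt_primitive_atTop (x : ℝ) :
    Tendsto (fun t : ℝ => (Real.log (1 + x ^ 2 + x * t + √(1 + x ^ 2) * √(1 + (x + t) ^ 2)) -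
        Real.log (1 + x ^ 2 - x * t + √(1 + x ^ 2) * √(1 + (x - t) ^ 2))) / √(1 + x ^ 2)) atTop
      (𝓝 ((Real.log (x + √(1 + x ^ 2)) - Real.log (√(1 + x ^ 2) - x)) / √(1 + x ^ 2))) := by
  have hB := (tendsto_NB_div_atTop x).log (add_sqrt_one_add_sq_pos x).ne'
  have hA := (tendsto_NA_div_atTop x).log (sqrt_one_add_sq_sub_pos x).ne'
  have h := (hB.sub hA).div_const (√(1 + x ^ 2))
  refine h.congr' ?_
  filter_upwards [eventually_gt_atTop (0:ℝ)] with t ht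
  have hNB : 0 < 1 + x ^ 2 + x * t + √(1 + x ^ 2) * √(1 + (x + t) ^ 2) := by linarith [two_le_NB x t]
  have hNA : 0 < 1 + x ^ 2 - x * t + √(1 + x ^ 2) * √(1 + (x - t) ^ 2) := by linarith [two_le_NA x t]
  rw [Real.log_div hNB.ne' ht.ne', Real.log_div hNA.ne' ht.ne']
  ring

/-- The value of the limit: `log(x + √(1+x²)) − log(√(1+x²) − x) = 2·arsinh x` (`(x + √(1+x²))(√(1+x²) − x) = 1`). [folklore] -/
theorem log_sub_log_eq_two_arsinh (x : ℝ) :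
    Real.log (x + √(1 + x ^ 2)) - Real.log (√(1 + x ^ 2) - x) = 2 * Real.arsinh x := by
  have hw : √(1 + x ^ 2) * √(1 + x ^ 2) = 1 + x ^ 2 := sqrt_one_add_sq_mul_self x
  have hmul : (x + √(1 + x ^ 2)) * (√(1 + x ^ 2) - x) = 1 := by linear_combination hw
  have hinv : √(1 + x ^ 2) - x = (x + √(1 + x ^ 2))⁻¹ := eq_inv_of_mul_eq_one_right hmul
  have harsinh : Real.arsinh x = Real.log (x + √(1 + x ^ 2)) := rfl
  rw [hinv, Real.log_inv, harsinh]
  ring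

/-! ### The closed forms -/

/-- **`H[(1 + y²)^{-1/2}](x) = (2/π)·arsinh(x)·(1 + x²)^{-1/2}`**: the Hilbert transform of the inverse square root. [folklore] -/
theorem hilbertTransform_inv_sqrt_one_add_sq (x : ℝ) :
    hilbertTransform (fun y => (√(1 + y ^ 2))⁻¹) x = 2 / π * Real.arsinh x / √(1 + x ^ 2) := by
  unfold hilbertTransform
  have hcongr : ∫ t in Ioi (0:ℝ), ((√(1 + (x - t) ^ 2))⁻¹ - (√(1 + (x + t) ^ 2))⁻¹) / t =
      ∫ t in Ioi (0:ℝ),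
        4 * x / (√(1 + (x - t) ^ 2) * √(1 + (x + t) ^ 2) * (√(1 + (x - t) ^ 2) + √(1 + (x + t) ^ 2))) :=
    setIntegral_congr_fun measurableSet_Ioi fun t ht => invSqrt_symm_integrand x (ne_of_gt ht)
  rw [hcongr]
  have hFTC := integral_Ioi_of_hasDerivAt_of_tendsto' (a := (0:ℝ))
    (fun t _ => hasDerivAt_invSqrt_primitive x t)
    (integrable_invSqrt_symm_integrand x).integrableOn (tendsto_invSqrt_primitive_atTop x)
  rw [hFTC, log_sub_log_eq_two_arsinh]
  have h0 : (Real.log (1 + x ^ 2 + x * 0 + √(1 + x ^ 2) * √(1 + (x + 0) ^ 2)) -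
        Real.log (1 + x ^ 2 - x * 0 + √(1 + x ^ 2) * √(1 + (x - 0) ^ 2))) / √(1 + x ^ 2) = 0 := by
    simp
  rw [h0, sub_zero]
  ring

/-- **`H[(L² + y²)^{-1/2}](x) = (2/π)·arsinh(x/L)·(L² + x²)^{-1/2}`** (`L > 0`), by dilation covariance — the closed form from which
the SHEET-ℝ certificate's far-field shape identities (`H T₂`, `𝒰 T₂` for `T₂ = ξ(L² + ξ²)^{-3/2} = −∂_ξ(L² + ξ²)^{-1/2}`) are derived
(cert-1 PRICE-impl1 §4 T1; cert-4 F5(b) design). [folklore] -/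
theorem hilbertTransform_inv_sqrt_sq_add_sq {L : ℝ} (hL : 0 < L) (x : ℝ) :
    hilbertTransform (fun y => (√(L ^ 2 + y ^ 2))⁻¹) x = 2 / π * Real.arsinh (x / L) / √(L ^ 2 + x ^ 2) := by
  have hL0 : L ≠ 0 := hL.ne'
  have hscale : ∀ y : ℝ, √(L ^ 2 + y ^ 2) = L * √(1 + (y / L) ^ 2) := by
    intro y
    have h : L ^ 2 + y ^ 2 = L ^ 2 * (1 + (y / L) ^ 2) := by field_simp
    rw [h, Real.sqrt_mul (by positivity), Real.sqrt_sq hL.le]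
  have hfun : (fun y : ℝ => (√(L ^ 2 + y ^ 2))⁻¹) = fun y => L⁻¹ * (√(1 + (y / L) ^ 2))⁻¹ := by
    funext y
    rw [hscale y, mul_inv]
  rw [hfun, hilbertTransform_const_mul,
    hilbertTransform_comp_div (fun y : ℝ => (√(1 + y ^ 2))⁻¹) hL x, hilbertTransform_inv_sqrt_one_add_sq, hscale x]
  have : √(1 + (x / L) ^ 2) ≠ 0 := by positivity
  field_simp

end SheetRFarFieldHilbert
end Summit.NavierStokesRegularity.OSWSelfSimilar
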